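import Mathlib
import HarnessLib
import Summits.ValiantsHypothesis.Statement
import Summits.ValiantsHypothesis.ValiantsHypothesis.Theses.SymmetryDial
import Literature.Computability.AlgebraicComplexity.SymmetricArithCircuit
import Literature.Computability.AlgebraicComplexity.StandardFamilies
import Literature.Computability.Complexity.SymmetricCircuit
import Literature.Computability.Complexity.ConstantDepth
import Literature.ModelTheory.FiniteModelTheory.SymmetricCircuitCountingWidth
import Summits.ValiantsHypothesis.ValiantsHypothesis.Theorems.SymmetryDialAffineCFIRung
import Summits.ValiantsHypothesis.ValiantsHypothesis.Theorems.SymmetryDialAffineThreshold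
import Summits.ValiantsHypothesis.ValiantsHypothesis.Theorems.SymmetryDialAffinePebble
import Summits.ValiantsHypothesis.ValiantsHypothesis.Theorems.SymmetryDialAffineTransferZero

/-!
# SymmetryDial — the affine CFI split of supported hardness (`SymHardAffineSupported`, A₂)

Decomposition workshop decomp-valiant, cycle 1 (VALIANT), lens 1 «representation-theoretic obstruction
splitting», generation 5.  LADDER-Valiant rung 0: nothing here proves VP ≠ VNP.

Route `route-ValiantsHypothesis-SymmetryDial`, item `stmt-ValiantsHypothesis-23711`
(`SymHardAffineSupported`, piece A₂ of the mechanism split of `SymHardAffine`).  This file types the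
lens template «existence of obstructions ∧ (obstruction ⇒ separation)» ON THE SYMMETRIC-CIRCUIT DIAL
and proves the glue in the kernel:

* `AffineThresholdTranslation` (Q, the TRANSLATION piece): every AGL_d(𝔽₂)-symmetric labelled
  arithmetic circuit over `ℂ` on the `𝔽₂^d × 𝔽₂^d` variables all of whose gates are `k`-supported (the
  verbatim gate condition of A₂: a flag-let fixator `Fix(U,W)`, `|U| ≤ k`, `[V : W] ≤ 2^k`, lies in the
  stabiliser) and every target set `S ⊆ ℂ` admit a Boolean threshold circuit on the same variables —
  over `tcBasis`, simply wired, symmetric under the diagonal action of AGL_d(𝔽₂), all gates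
  `(k+2)`-supported in the same sense, of ANY size — deciding `Φ[A] ∈ S` on `0/1` matrices `A`.
  This is Dawar–Wilsenach 2025, Thm 5.1, made `Γ`-relative and support-preserving; size plays no role.
  Its `Sym_n`, orbit-counting form is the tree theorem
  `LabelledArithCircuit.thresholdCircuit_eval/_isSymmetricUnder/_isOver/_hasSimpleWiring`.
  Rev 3: Q is PROVED — `Theorems.SymmetryDialAffineThreshold.affineThresholdTranslation` (p749017),
  read back here as `affineThresholdTranslation_holds`; hence `symHardAffineSupported_of_cfiPairs :
  AffineCFIPairs → SymHardAffineSupported` (A₂ ⟸ P alone).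
  Rev 4: P ⟸ `AffineLogicTransfer` (T, THEOREM-INPUT) ∧ `SymmetryDialAffinePebble.AffinePebblePairs`
  (P′, the bijective-pebble-game form typed over `StructCkEquiv`): `symHardAffineSupported_of_pebble`.
  Rev 5: rung `T(0)` PROVED — `affineLogicTransfer_zero` (k = 0, k′ = 2; budget-`0` circuits count the
  two `AGL_d`-orbits of positions), read back from `Theorems.SymmetryDialAffineTransferZero`.
* `AffineCFIPairs` (P, the OBSTRUCTION piece): for every budget `k` there are a dimension `d` and two
  `0/1` matrices `A, B : 𝔽₂^d × 𝔽₂^d → {0,1}` with DIFFERENT `0/1`-permanents on which every such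
  admissible Boolean circuit (budget `k`, any size) takes the same value — the affine Cai–Fürer–Immerman
  statement (for `Sym_n` and counting width this is Dawar–Wilsenach Thm 7.2 + Anderson–Dawar's support
  theorem; for the affine group it is OPEN and is the idea-needing heart of A₂).
* Kernel glue: `AffineCFIPairs → AffineThresholdTranslation → SymHardAffineSupportedAnySize` and
  `SymHardAffineSupportedAnySize → SymHardAffineSupported` (the polynomial size bound of A₂ is not used:
  after the support split, size has already been spent on supports via orbit–stabiliser, item 23712).

All statements are over existing declarations (`Circuit.IsInducedAut`, `Circuit.IsOver`, `tcBasis`,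
`Circuit.HasSimpleWiring`, `LabelledArithCircuit.IsSymmetric/IsAutomorphismExtending/eval`, `perPoly`).
-/

set_option linter.dupNamespace false

namespace Summit.ValiantsHypothesis.ValiantsHypothesis.Theorems.SymmetryDialAffineCFISplit

open Literature.Computability.AlgebraicComplexity
open Literature.Computability.Complexity
open Summit.ValiantsHypothesis.ValiantsHypothesis.Theses.SymmetryDial

/-! ### The affine dial: vocabulary (verbatim carriers of the route file) -/

/-- The index set `𝔽₂^d`, typed as in the route file. -/
abbrev V (d : ℕ) : Type := Fin d → Fin 2

/-- `AGL_d(𝔽₂)` as in the route file: the subgroup of `Sym(𝔽₂^d)` generated by the permutations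
preserving `x + y + z` (these already form a group; the closure is the route's verbatim carrier). -/
abbrev AGL (d : ℕ) : Subgroup (Equiv.Perm (V d)) :=
  Subgroup.closure {σ : Equiv.Perm (Fin d → Fin 2) | ∀ x y z : Fin d → Fin 2, σ (x + y + z) = σ x + σ y + σ z}

/-- The diagonal action of `σ ∈ Sym(𝔽₂^d)` on matrix positions. -/
def diag {d : ℕ} (σ : Equiv.Perm (V d)) : V d × V d → V d × V d := fun q => (σ q.1, σ q.2)

/-- **`k`-supported gate of a labelled arithmetic circuit** (verbatim the gate condition of
`SymHardAffineSupported`): some flag-let fixator `Fix(U,W) = {σ ∈ AGL : σ|_U = id, ∀ v, σ v + v ∈ W}` with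
`|U| ≤ k`, `[𝔽₂^d : W] ≤ 2^k` lies in the stabiliser of `g` (every such `σ` has an automorphism
extension fixing `g`). -/
def ArithSupported {d : ℕ} {G : Type} (C : LabelledArithCircuit ℂ (V d × V d) Unit G) (k : ℕ)
    (g : G) : Prop :=
  ∃ (U : Finset (V d)) (W : AddSubgroup (V d)), U.card ≤ k ∧ W.index ≤ 2 ^ k ∧
    ∀ σ : ↥(AGL d), (∀ u ∈ U, σ.1 u = u) → (∀ v : V d, σ.1 v + v ∈ W) →
      ∃ π : Equiv.Perm G, C.IsAutomorphismExtending σ π ∧ π g = g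

/-- **`k`-supported gate of a Boolean straight-line circuit** on the matrix positions, for the
diagonal action of AGL_d(𝔽₂): the same flag-let condition, with Anderson–Dawar induced automorphisms
(`Circuit.IsInducedAut`) in place of labelled-circuit automorphisms. -/
def BoolSupported {d : ℕ} (Ψ : Circuit (V d × V d)) (k : ℕ) (j : Fin Ψ.gates.length) : Prop :=
  ∃ (U : Finset (V d)) (W : AddSubgroup (V d)), U.card ≤ k ∧ W.index ≤ 2 ^ k ∧
    ∀ σ : ↥(AGL d), (∀ u ∈ U, σ.1 u = u) → (∀ v : V d, σ.1 v + v ∈ W) →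
      ∃ τ : Equiv.Perm (Fin Ψ.gates.length), Ψ.IsInducedAut (diag σ.1) τ ∧ τ j = j

/-- **AGL-symmetric Boolean circuit** on matrix positions (Dawar–Wilsenach Def. 3.7 for the diagonal
image of AGL_d(𝔽₂) in `Sym(𝔽₂^d × 𝔽₂^d)`). -/
def BoolSymmetric {d : ℕ} (Ψ : Circuit (V d × V d)) : Prop :=
  ∀ σ : ↥(AGL d), ∃ τ : Equiv.Perm (Fin Ψ.gates.length), Ψ.IsInducedAut (diag σ.1) τ

/-- **Admissible Boolean circuits at budget `k`**: threshold basis, simple wiring, AGL-symmetric, every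
gate `k`-supported.  No size bound. -/
def Admissible {d : ℕ} (k : ℕ) (Ψ : Circuit (V d × V d)) : Prop :=
  Ψ.IsOver tcBasis ∧ Ψ.HasSimpleWiring ∧ BoolSymmetric Ψ ∧ ∀ j : Fin Ψ.gates.length, BoolSupported Ψ k j

/-- Evaluation of a polynomial in the matrix variables at a `0/1` matrix (as in
`LabelledArithCircuit.thresholdCircuit_eval`). -/
noncomputable def boolEval {d : ℕ} (p : MvPolynomial (V d × V d) ℂ) (A : V d × V d → Bool) : ℂ :=
  MvPolynomial.eval (fun ij => if A ij = true then (1 : ℂ) else 0) p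

/-! ### The two pieces -/

/-- **Q — affine, support-preserving threshold translation** (Dawar–Wilsenach 2025, Thm 5.1, relative
to AGL_d(𝔽₂) and with supports traced instead of orbits counted).  THEOREM-INPUT: the tree proves the
`Sym_n`/orbit form (`thresholdCircuit_*`); the `Γ`-relative, stabiliser-tracing form is routine but
landed in rev 3 as `affineThresholdTranslation_holds` (via `Theorems.SymmetryDialAffineThreshold`).  The budget
`k + 2` pays for the negated-input gates `¬x_{uv}` (support `{u,v}`). -/
def AffineThresholdTranslation : Prop :=
  ∀ (k d : ℕ) (G : Type) [Fintype G] (C : LabelledArithCircuit ℂ (V d × V d) Unit G),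
    C.IsSymmetric ↥(AGL d) → (∀ g : G, ArithSupported C k g) →
    ∀ S : Set ℂ, ∃ Ψ : Circuit (V d × V d), Admissible (k + 2) Ψ ∧
      ∀ A : V d × V d → Bool, Ψ.eval A = true ↔ boolEval (C.eval (C.output ())) A ∈ S

/-- **P — affine CFI pairs** (the obstruction): for every support budget `k` some dimension `d` carries
two `0/1` matrices with different `0/1`-permanents that no admissible circuit of budget `k` — of any
size — tells apart.  OPEN (idea-needed); its `Sym_n` analogue is Dawar–Wilsenach 2025 Thm 7.2 with
Anderson–Dawar 2017 Thm 4. -/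
def AffineCFIPairs : Prop :=
  ∀ k : ℕ, ∃ (d : ℕ) (A B : V d × V d → Bool),
    (∀ Ψ : Circuit (V d × V d), Admissible k Ψ → Ψ.eval A = Ψ.eval B) ∧
    boolEval (perPoly (V d) ℂ) A ≠ boolEval (perPoly (V d) ℂ) B

/-- **A₂^∞ — supported hardness at any size**: for every budget `k` some dimension `d` admits NO
AGL_d(𝔽₂)-symmetric, everywhere-`k`-supported labelled arithmetic circuit over `ℂ` (finite, of any size)
computing `per_d`.  Trivially implies `SymHardAffineSupported` (which only excludes p-bounded families). -/
def SymHardAffineSupportedAnySize : Prop :=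
  ∀ k : ℕ, ∃ d : ℕ, ∀ (G : Type) [Fintype G] (C : LabelledArithCircuit ℂ (V d × V d) Unit G),
    C.IsSymmetric ↥(AGL d) → (∀ g : G, ArithSupported C k g) →
      C.eval (C.output ()) ≠ perPoly (V d) ℂ

/-! ### Kernel glue -/

/-- **P → Q → A₂^∞.**  Given `k`, take the CFI pair `(A, B)` at budget `k + 2`; a `k`-supported symmetric
circuit for `per_d` translates (Q, target set `{per(A)}`) into an admissible budget-`(k+2)` threshold
circuit accepting exactly the matrices with `per = per(A)`; it accepts `A`, hence `B` (P), so
`per(B) = per(A)` — contradiction. -/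
theorem anySize_of_cfiSplit (hP : AffineCFIPairs) (hQ : AffineThresholdTranslation) :
    SymHardAffineSupportedAnySize := by
  intro k
  obtain ⟨d, A, B, hfool, hper⟩ := hP (k + 2)
  refine ⟨d, fun G _ C hsym hsupp heval => ?_⟩
  obtain ⟨Ψ, hadm, hdec⟩ := hQ k d G C hsym hsupp {boolEval (perPoly (V d) ℂ) A}
  have hA : Ψ.eval A = true := (hdec A).2 (by rw [heval]; exact Set.mem_singleton _)
  have hB : Ψ.eval B = true := (hfool Ψ hadm) ▸ hA
  have hBmem := (hdec B).1 hB
  rw [heval, Set.mem_singleton_iff] at hBmem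
  exact hper hBmem.symm

/-- **A₂^∞ → A₂**: a p-bounded family is in particular a circuit at the bad dimension. -/
theorem symHardAffineSupported_of_anySize (h : SymHardAffineSupportedAnySize) :
    SymHardAffineSupported := by
  intro k
  obtain ⟨d, hd⟩ := h k
  rintro ⟨t, -, hC⟩
  obtain ⟨G, hG, C, hsym, heval, -, hsupp⟩ := hC d
  exact hd G C hsym hsupp heval

/-- **The affine CFI split of A₂, glued in the kernel**:
`AffineCFIPairs → AffineThresholdTranslation → SymHardAffineSupported`. -/
theorem symHardAffineSupported_of_cfiSplit (hP : AffineCFIPairs) (hQ : AffineThresholdTranslation) :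
    SymHardAffineSupported :=
  symHardAffineSupported_of_anySize (anySize_of_cfiSplit hP hQ)

/-- **Rung R₀ of `AffineCFIPairs`, by name (rev 2).** The budget-`0` instance of `AffineCFIPairs`
holds, in dimension `2`: this is `SymmetryDialAffineCFIRung.affineCFIPairs_rung_zero` (which does not
even use the simple-wiring clause of `Admissible`) read against the typed definitions of this file. -/
theorem affineCFIPairs_zero :
    ∃ (d : ℕ) (A B : V d × V d → Bool),
      (∀ Ψ : Circuit (V d × V d), Admissible 0 Ψ → Ψ.eval A = Ψ.eval B) ∧
        boolEval (perPoly (V d) ℂ) A ≠ boolEval (perPoly (V d) ℂ) B := by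
  obtain ⟨A, B, hAB, hper⟩ := SymmetryDialAffineCFIRung.affineCFIPairs_rung_zero
  exact ⟨2, A, B, fun Ψ hΨ => hAB Ψ hΨ.1 hΨ.2.2.1 hΨ.2.2.2, hper⟩

/-! ### Arithmetic ladder floor: A₂ at budget `0` (rev 2)

In Dawar–Wilsenach's model the inputs are *gates* (labelled `var`), so they carry the support condition
too.  At budget `0` the fixator is all of `AGL_d`, which (for `d ≥ 1`) contains a fixed-point-free
translation; an automorphism extending it and fixing a `var (u,v)` gate would fix its label, so there
are no variable gates at all, the circuit computes a constant, and a constant is not the permanent.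
Hence the `k = 0` instance of `SymHardAffineSupported` holds outright — the arithmetic ladder of A₂ is
degenerate at its floor (the Boolean obstruction `AffineCFIPairs` is not: `affineCFIPairs_zero`). -/

section ArithmeticFloor

/-- The nonzero vector of `𝔽₂¹`. -/
def c1 : V 1 := fun _ => 1

/-- `𝔽₂¹` has exponent `2`. -/
theorem two_self_one (c : V 1) : c + c = 0 := by
  funext i
  have h : ∀ a : Fin 2, a + a = 0 := by decide
  exact h (c i)

/-- Translation by `c1` lies in `AGL₁` (translations preserve `x + y + z` in characteristic `2`). -/
theorem addRight_c1_mem : Equiv.addRight c1 ∈ AGL 1 := by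
  refine Subgroup.subset_closure ?_
  intro x y z
  simp only [Equiv.coe_addRight]
  rw [show x + c1 + (y + c1) + (z + c1) = x + y + z + c1 + (c1 + c1) by abel, two_self_one, add_zero]

/-- In an everywhere-`0`-supported circuit over `𝔽₂¹ × 𝔽₂¹` no gate is a variable gate. -/
theorem label_ne_var_of_supported_zero {G : Type} (C : LabelledArithCircuit ℂ (V 1 × V 1) Unit G)
    (hsupp : ∀ g : G, ArithSupported C 0 g) (g : G) (x : V 1 × V 1) : C.label g ≠ .var x := by
  intro hlab
  obtain ⟨U, W, hU, hW, hfix⟩ := hsupp g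
  have hU0 : U = ∅ := Finset.card_eq_zero.1 (Nat.le_zero.1 hU)
  have hW1 : W = ⊤ := by
    rw [← AddSubgroup.index_eq_one]
    have := AddSubgroup.index_ne_zero_of_finite (H := W)
    simp only [pow_zero] at hW
    omega
  obtain ⟨π, hπ, hπg⟩ :=
    hfix ⟨Equiv.addRight c1, addRight_c1_mem⟩ (by simp [hU0]) (by simp [hW1])
  have hl := hπ.label_apply g
  rw [hπg, hlab] at hl
  have hx : x = (⟨Equiv.addRight c1, addRight_c1_mem⟩ : ↥(AGL 1)) • x := CircuitLabel.var.inj hl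
  have h1 : x.1 0 = x.1 0 + c1 0 := congrFun (congrArg Prod.fst hx) 0
  have hne : ∀ a : Fin 2, a ≠ a + 1 := by decide
  exact hne _ h1

/-- A circuit without variable gates evaluates to the same number under any two assignments. -/
theorem eval_eval_eq_of_no_var {G : Type} (C : LabelledArithCircuit ℂ (V 1 × V 1) Unit G)
    (hnv : ∀ (g : G) (x : V 1 × V 1), C.label g ≠ .var x) (a b : V 1 × V 1 → ℂ) (g : G) :
    MvPolynomial.eval a (C.eval g) = MvPolynomial.eval b (C.eval g) := by
  refine @WellFounded.induction _ _ C.wf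
    (fun g => MvPolynomial.eval a (C.eval g) = MvPolynomial.eval b (C.eval g)) g (fun g ih => ?_)
  rcases hlab : C.label g with x | c | _ | _
  · exact absurd hlab (hnv g x)
  · rw [C.eval_of_label_const hlab]
    simp
  · rw [C.eval_of_label_add hlab, map_sum, map_sum]
    exact Finset.sum_congr rfl fun h hh => ih h hh
  · rw [C.eval_of_label_mul hlab, map_prod, map_prod]
    exact Finset.prod_congr rfl fun h hh => ih h hh

/-- `per` of the `2 × 2` zero matrix is `0`. -/
theorem eval_perPoly_one_zero : MvPolynomial.eval (fun _ => (0 : ℂ)) (perPoly (V 1) ℂ) = 0 := by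
  simp [perPoly, Matrix.permanent, Matrix.mvPolynomialX_apply]

/-- `per` of the `2 × 2` all-ones matrix is not `0` (it is `2`). -/
theorem eval_perPoly_one_one : MvPolynomial.eval (fun _ => (1 : ℂ)) (perPoly (V 1) ℂ) ≠ 0 := by
  simp [perPoly, Matrix.permanent, Matrix.mvPolynomialX_apply]

/-- **Arithmetic ladder floor (budget `0`).**  The `k = 0` instance of the route decl
`SymHardAffineSupported` (its body verbatim, with `ArithSupported C 0 g` for the gate clause): no
p-bounded family of `AGL_d`-symmetric everywhere-`0`-supported circuits computes the permanent — in
fact already the `d = 1` member cannot, whatever its size, and symmetry is not even used. -/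
theorem symHardAffineSupported_zero :
    ¬ ∃ t : ℕ → ℕ, IsPBounded t ∧ ∀ d : ℕ, ∃ (G : Type) (_ : Fintype G)
      (C : LabelledArithCircuit ℂ (V d × V d) Unit G),
      C.IsSymmetric ↥(AGL d) ∧ C.eval (C.output ()) = perPoly (V d) ℂ ∧
        Fintype.card G ≤ t (2 ^ d) ∧ ∀ g : G, ArithSupported C 0 g := by
  rintro ⟨t, -, h⟩
  obtain ⟨G, _, C, -, heval, -, hsupp⟩ := h 1
  have hnv := label_ne_var_of_supported_zero C hsupp
  have h01 := eval_eval_eq_of_no_var C hnv (fun _ => 0) (fun _ => 1) (C.output ())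
  rw [heval, eval_perPoly_one_zero] at h01
  exact eval_perPoly_one_one h01.symm

end ArithmeticFloor


/-! ### Q by name (rev 3): the translation piece is a THEOREM

`Theorems.SymmetryDialAffineThreshold` (Literature-only imports) proves Q with this file's definitions
unfolded; here it is read back by name, and the split collapses to its idea-needing half:
`AffineCFIPairs → SymHardAffineSupported`. -/

section QByName

/-- **Q holds**: `AffineThresholdTranslation` (Dawar–Wilsenach Thm 5.1, `AGL_d`-relative and
support-tracing) is a theorem of the tree. -/
theorem affineThresholdTranslation_holds : AffineThresholdTranslation := by
  intro k d G _ C hsym hsupp S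
  exact SymmetryDialAffineThreshold.affineThresholdTranslation k d G C hsym hsupp S

/-- **The split after Q**: supported affine hardness at any size follows from affine CFI pairs alone. -/
theorem anySize_of_cfiPairs (hP : AffineCFIPairs) : SymHardAffineSupportedAnySize :=
  anySize_of_cfiSplit hP affineThresholdTranslation_holds

/-- **A₂ ⟸ P**: the route item `SymHardAffineSupported` (23711) follows from `AffineCFIPairs` alone. -/
theorem symHardAffineSupported_of_cfiPairs (hP : AffineCFIPairs) :
    SymHardAffineSupported :=
  symHardAffineSupported_of_cfiSplit hP affineThresholdTranslation_holds

end QByName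


/-! ### P through the pebble game (rev 4): `AffineLogicTransfer → AffinePebblePairs → AffineCFIPairs`

`Theorems.SymmetryDialAffinePebble` types the affine matrix structures `𝔄_d(A)` and their
`C^{k′}`-equivalence `AffinePebbleEquiv` (the tree's bijective pebble game `StructCkEquiv`) and the
logical form P′ = `AffinePebblePairs` of the obstruction.  The remaining input is the TRANSFER theorem
below — the affine, any-size form of the Anderson–Dawar simulation of supported symmetric circuits in
bounded-variable counting logic (THEOREM-INPUT, provable but large: rigidify by `GateDAG.reduce`, then a
gate with flag-let support `(U, W)` is determined by the images of `U`, of `≤ k` dual vectors cutting out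
`W` and of `k + 1` coset representatives, so gate values are `C^{O(k)}_{∞ω}`-definable over `𝔄_d(A)`
by induction along the circuit, threshold gates by counting quantifiers). -/

section PebbleTransfer

/-- **T — affine circuit-to-logic transfer** (Anderson–Dawar 2017 Thm 4 / Dawar 2015 §3, made
`AGL_d`-relative, flag-let-supported and size-free): for every support budget `k` there is a number of
pebbles `k′` such that admissible circuits of budget `k` (any size) take equal values on `0/1` matrices
whose affine matrix structures are `C^{k′}`-equivalent.  THEOREM-INPUT (not yet landed). -/
def AffineLogicTransfer : Prop :=
  ∀ k : ℕ, ∃ k' : ℕ, ∀ (d : ℕ) (A B : V d × V d → Bool),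
    SymmetryDialAffinePebble.AffinePebbleEquiv k' d A B →
      ∀ Ψ : Circuit (V d × V d), Admissible k Ψ → Ψ.eval A = Ψ.eval B

/-- **P ⟸ T ∧ P′**: affine CFI pairs follow from the transfer theorem and affine pebble pairs. -/
theorem affineCFIPairs_of_pebble (hT : AffineLogicTransfer)
    (hP' : SymmetryDialAffinePebble.AffinePebblePairs) : AffineCFIPairs := by
  intro k
  obtain ⟨k', hk'⟩ := hT k
  obtain ⟨d, A, B, hAB, hper⟩ := hP' k'
  exact ⟨d, A, B, fun Ψ hΨ => hk' d A B hAB Ψ hΨ, hper⟩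

/-- **A₂ ⟸ T ∧ P′**: the route item `SymHardAffineSupported` (23711) from the transfer theorem and
affine pebble pairs (with Q already a theorem, rev 3). -/
theorem symHardAffineSupported_of_pebble (hT : AffineLogicTransfer)
    (hP' : SymmetryDialAffinePebble.AffinePebblePairs) : SymHardAffineSupported :=
  symHardAffineSupported_of_cfiPairs (affineCFIPairs_of_pebble hT hP')

end PebbleTransfer


/-! ### Rung T(0): the transfer statement at budget `0` (by name) -/

section TransferZero

/-- **Rung `T(0)`** — the `k = 0` instance of `AffineLogicTransfer` (with `k′ = 2`), read back by name from
`Theorems/SymmetryDialAffineTransferZero.lean`: budget-`0` admissible circuits of any size compute a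
function of the numbers of diagonal / off-diagonal ones (`AGL_d` has two orbits on positions), and two
rounds of the bijective pebble game on `𝔄_d(A)`, `𝔄_d(B)` equalise those numbers. -/
theorem affineLogicTransfer_zero :
    ∃ k' : ℕ, ∀ (d : ℕ) (A B : V d × V d → Bool),
      SymmetryDialAffinePebble.AffinePebbleEquiv k' d A B →
        ∀ Ψ : Circuit (V d × V d), Admissible 0 Ψ → Ψ.eval A = Ψ.eval B := by
  obtain ⟨k', hk'⟩ := SymmetryDialAffineTransferZero.affineLogicTransfer_zero
  exact ⟨k', fun d A B hAB Ψ hadm => hk' d A B hAB Ψ hadm.1 hadm.2.2.1 hadm.2.2.2⟩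

end TransferZero

end Summit.ValiantsHypothesis.ValiantsHypothesis.Theorems.SymmetryDialAffineCFISplit
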